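import Literature.MathematicalPhysics.QuantumLattice.HeisenbergModel
import Mathlib.Combinatorics.SimpleGraph.Maps
import Mathlib.Data.Fintype.BigOperators

/-!
# Route `AnisotropyChord`: the COPY BLOW-UP of a spin system — graph, copy counts, and the
# symmetrisation isometry `J` (definitions; theory seat memo ROTOR-THEORY-6 §72)

The copy blow-up replaces every site `x` of a graph `G` on `V` by `n` spin-½ copies `(x, i)`,
`i : Fin n`, and every edge `xy` by the complete bipartite bundle between the copies
(`blowUpGraph n G = G.comap Prod.fst`).  A spin-½ configuration `τ : V × Fin n → Fin 2` has COPY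
COUNTS `blowUpCount n τ : V → Fin (n+1)`, `x ↦ #{i | τ (x,i) = 1}` — a spin-`n/2` configuration in
the tree's convention (`Sᶻ = n/2 − k`).  The symmetrisation isometry
`blowUpIso n : Matrix (V × Fin n → Fin 2) (V → Fin (n+1)) ℂ`,
`J(τ, k) = [blowUpCount τ = k] · N(k)^{−1/2}`, `N(k) = #{τ | blowUpCount τ = k} = Π_x C(n, k_x)`, maps the
spin-`n/2` basis vector `|k⟩` to the normalised symmetric sum of the spin-½ configurations with copy
counts `k` (Dicke states, sitewise).  Proved here: the fibre count `card_filter_blowUpCount`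
(`= Π_x C(n, k_x)`, positive) and the isometry property `blowUpIso_conjTranspose_mul_self : Jᴴ J = 1`.

This is the vocabulary of the theory seat's §72 reduction «spin-`S` XXZ on `G` = spin-½ XXZ on the
blow-up restricted to the copy-symmetric subspace», used downstream to transfer E-CONV / A-STAB from
spin ½ to every spin.  Theory seat `hubbard-h0-rotor-theory-1` (memo ROTOR-THEORY-6 §72); the
construction is the standard Schwinger/Dicke symmetrisation (H. Tasaki, *Physics and Mathematics of
Quantum Many-Body Systems* (2020) §2.1, spin-`S` as symmetric tensors of spin ½).
-/

set_option linter.dupNamespace false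

noncomputable section

namespace Summit.HubbardSuperconductivity.HubbardSuperconductivity.Theorems.AnisotropyChord

open Matrix Complex Finset
open Literature.MathematicalPhysics.QuantumLattice

variable {V : Type} [Fintype V] [DecidableEq V]

/-- The copy blow-up graph on `V × Fin n`: `(x,i) ∼ (y,j)` iff `x ∼ y` in `G` (every edge becomes a
complete bipartite bundle `K_{n,n}` between the copies; no edges inside a fibre).  Theory seat memo
ROTOR-THEORY-6 §72. [folklore] -/
abbrev blowUpGraph (n : ℕ) (G : SimpleGraph V) : SimpleGraph (V × Fin n) :=
  G.comap Prod.fst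

/-- The copy counts of a spin-½ configuration of the blow-up: `x ↦ #{i | τ (x, i) = 1}`, a
spin-`n/2` configuration (`Sᶻ_x = n/2 − k_x`).  Theory seat memo ROTOR-THEORY-6 §72. [folklore] -/
def blowUpCount (n : ℕ) (τ : V × Fin n → Fin 2) : V → Fin (n + 1) :=
  fun x => ⟨(Finset.univ.filter fun i : Fin n => τ (x, i) = 1).card,
    Nat.lt_succ_of_le ((Finset.card_filter_le _ _).trans (by rw [Finset.card_univ, Fintype.card_fin]))⟩

/-- The number of spin-½ configurations of the blow-up with prescribed copy counts `k`,
`N(k) = #{τ | blowUpCount τ = k}` (as a real number; `= Π_x C(n, k_x)` by `card_filter_blowUpCount`).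
[folklore] -/
def blowUpFibreCard (n : ℕ) (k : V → Fin (n + 1)) : ℝ :=
  ((Finset.univ.filter fun τ : V × Fin n → Fin 2 => blowUpCount n τ = k).card : ℝ)

/-- The SYMMETRISATION ISOMETRY `J : ℂ^{(V → Fin (n+1))} → ℂ^{(V × Fin n → Fin 2)}`,
`J(τ, k) = [blowUpCount τ = k] N(k)^{−1/2}`: the spin-`n/2` basis state `|k⟩` goes to the normalised
symmetric sum of the spin-½ configurations with copy counts `k` (sitewise Dicke states).
Theory seat memo ROTOR-THEORY-6 §72; Tasaki (2020) §2.1. [folklore] -/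
def blowUpIso (n : ℕ) : Matrix (V × Fin n → Fin 2) (V → Fin (n + 1)) ℂ :=
  fun τ k => if blowUpCount n τ = k then (((Real.sqrt (blowUpFibreCard n k))⁻¹ : ℝ) : ℂ) else 0

/-! ### Fibre counts -/

omit [Fintype V] [DecidableEq V] in
/-- Value of the copy count at a site. [folklore] -/
theorem blowUpCount_apply_val (n : ℕ) (τ : V × Fin n → Fin 2) (x : V) :
    ((blowUpCount n τ x : Fin (n + 1)) : ℕ) = (Finset.univ.filter fun i : Fin n => τ (x, i) = 1).card :=
  rfl

omit [Fintype V] [DecidableEq V] in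
/-- Per-site count: the spin-½ configurations of `n` copies with exactly `m` values `1` are `C(n, m)`
in number (bijection with `m`-subsets of `Fin n`). [folklore] -/
theorem card_filter_copies (n m : ℕ) :
    (Finset.univ.filter fun ρ : Fin n → Fin 2 =>
        (Finset.univ.filter fun i : Fin n => ρ i = 1).card = m).card = n.choose m := by
  have h : n.choose m = (Finset.powersetCard m (Finset.univ : Finset (Fin n))).card := by
    rw [Finset.card_powersetCard, Finset.card_univ, Fintype.card_fin]
  rw [h]
  refine Finset.card_bij (fun ρ _ => Finset.univ.filter fun i : Fin n => ρ i = 1) ?_ ?_ ?_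
  · intro ρ hρ
    rw [Finset.mem_filter] at hρ
    rw [Finset.mem_powersetCard]
    exact ⟨Finset.filter_subset _ _, hρ.2⟩
  · intro ρ₁ h₁ ρ₂ h₂ h
    funext i
    have hi := congrArg (fun s : Finset (Fin n) => i ∈ s) h
    simp only [Finset.mem_filter, Finset.mem_univ, true_and, eq_iff_iff] at hi
    rcases Fin.exists_fin_two.mp ⟨ρ₁ i, rfl⟩ with ha | ha <;>
      rcases Fin.exists_fin_two.mp ⟨ρ₂ i, rfl⟩ with hb | hb
    · rw [ha, hb]
    · exact absurd (hi.mpr hb) (by rw [ha]; decide)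
    · exact absurd (hi.mp ha) (by rw [hb]; decide)
    · rw [ha, hb]
  · intro s hs
    rw [Finset.mem_powersetCard] at hs
    refine ⟨fun i => if i ∈ s then 1 else 0, ?_, ?_⟩
    · rw [Finset.mem_filter]
      refine ⟨Finset.mem_univ _, ?_⟩
      rw [← hs.2]
      congr 1
      ext i
      simp only [Finset.mem_filter, Finset.mem_univ, true_and]
      by_cases hi : i ∈ s <;> simp [hi]
    · ext i
      simp only [Finset.mem_filter, Finset.mem_univ, true_and]
      by_cases hi : i ∈ s <;> simp [hi]

/-- **Fibre count:** the spin-½ configurations of the blow-up with copy counts `k` are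
`Π_x C(n, k_x)` in number (the configuration curries to an independent choice per site). [folklore] -/
theorem card_filter_blowUpCount (n : ℕ) (k : V → Fin (n + 1)) :
    (Finset.univ.filter fun τ : V × Fin n → Fin 2 => blowUpCount n τ = k).card =
      ∏ x, n.choose (k x : ℕ) := by
  have hpi : (Fintype.piFinset fun x : V => Finset.univ.filter fun ρ : Fin n → Fin 2 =>
      (Finset.univ.filter fun i : Fin n => ρ i = 1).card = (k x : ℕ)).card = ∏ x, n.choose (k x : ℕ) := by
    rw [Fintype.card_piFinset]
    exact Finset.prod_congr rfl fun x _ => card_filter_copies n (k x)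
  rw [← hpi]
  refine Finset.card_bij (fun τ _ => fun x i => τ (x, i)) ?_ ?_ ?_
  · intro τ hτ
    rw [Finset.mem_filter] at hτ
    rw [Fintype.mem_piFinset]
    intro x
    rw [Finset.mem_filter]
    refine ⟨Finset.mem_univ _, ?_⟩
    rw [← blowUpCount_apply_val, hτ.2]
  · intro τ₁ _ τ₂ _ h
    funext p
    have := congrFun (congrFun h p.1) p.2
    exact this
  · intro f hf
    rw [Fintype.mem_piFinset] at hf
    refine ⟨fun p => f p.1 p.2, ?_, rfl⟩
    rw [Finset.mem_filter]
    refine ⟨Finset.mem_univ _, ?_⟩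
    funext x
    have hx := hf x
    rw [Finset.mem_filter] at hx
    exact Fin.ext hx.2

/-- The fibre count as a real number is `Π_x C(n, k_x)`, in particular positive. [folklore] -/
theorem blowUpFibreCard_eq (n : ℕ) (k : V → Fin (n + 1)) :
    blowUpFibreCard n k = ∏ x, (n.choose (k x : ℕ) : ℝ) := by
  rw [blowUpFibreCard, card_filter_blowUpCount]
  push_cast
  rfl

/-- The fibre count is positive (`k_x ≤ n`). [folklore] -/
theorem blowUpFibreCard_pos (n : ℕ) (k : V → Fin (n + 1)) : 0 < blowUpFibreCard n k := by
  rw [blowUpFibreCard_eq]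
  refine Finset.prod_pos fun x _ => ?_
  exact_mod_cast Nat.choose_pos (Nat.le_of_lt_succ (k x).isLt)

/-! ### The isometry -/

/-- Entries of `J`. [folklore] -/
theorem blowUpIso_apply (n : ℕ) (τ : V × Fin n → Fin 2) (k : V → Fin (n + 1)) :
    blowUpIso n τ k =
      if blowUpCount n τ = k then (((Real.sqrt (blowUpFibreCard n k))⁻¹ : ℝ) : ℂ) else 0 :=
  rfl

/-- The entries of `J` are real (fixed by `star`). [folklore] -/
theorem star_blowUpIso_apply (n : ℕ) (τ : V × Fin n → Fin 2) (k : V → Fin (n + 1)) :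
    star (blowUpIso n τ k) = blowUpIso n τ k := by
  rw [blowUpIso_apply]
  split_ifs
  · rw [Complex.star_def, Complex.conj_ofReal]
  · rw [star_zero]

/-- **`J` is an isometry: `Jᴴ J = 1`.**  Column `k` of `J` is supported on the fibre of `k`, with
constant value `N(k)^{−1/2}`, and the fibre has `N(k)` elements. [folklore] -/
theorem blowUpIso_conjTranspose_mul_self (n : ℕ) :
    (blowUpIso n : Matrix (V × Fin n → Fin 2) (V → Fin (n + 1)) ℂ)ᴴ *
      (blowUpIso n : Matrix (V × Fin n → Fin 2) (V → Fin (n + 1)) ℂ) =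
      (1 : Matrix (V → Fin (n + 1)) (V → Fin (n + 1)) ℂ) := by
  ext k k'
  rw [Matrix.mul_apply, Matrix.one_apply]
  have hentry : ∀ τ : V × Fin n → Fin 2,
      (blowUpIso n : Matrix (V × Fin n → Fin 2) (V → Fin (n + 1)) ℂ)ᴴ k τ * blowUpIso n τ k' =
        if blowUpCount n τ = k then
          (if k = k' then (((blowUpFibreCard n k)⁻¹ : ℝ) : ℂ) else 0) else 0 := by
    intro τ
    rw [Matrix.conjTranspose_apply, star_blowUpIso_apply, blowUpIso_apply, blowUpIso_apply]
    by_cases h1 : blowUpCount n τ = k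
    · rw [if_pos h1, if_pos h1]
      by_cases h2 : k = k'
      · subst h2
        rw [if_pos h1, if_pos rfl, ← Complex.ofReal_mul, ← mul_inv,
          Real.mul_self_sqrt (blowUpFibreCard_pos n k).le]
      · rw [if_neg (fun h => h2 (h1.symm.trans h)), if_neg h2, mul_zero]
    · rw [if_neg h1, if_neg h1, zero_mul]
  rw [Finset.sum_congr rfl fun τ _ => hentry τ, ← Finset.sum_filter, Finset.sum_const, nsmul_eq_mul]
  have hN : (((Finset.univ.filter fun τ : V × Fin n → Fin 2 => blowUpCount n τ = k).card : ℕ) : ℂ) =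
      ((blowUpFibreCard n k : ℝ) : ℂ) := by
    rw [blowUpFibreCard]; push_cast; rfl
  rw [hN]
  by_cases hkk : k = k'
  · subst hkk
    rw [if_pos rfl, if_pos rfl, ← Complex.ofReal_mul, mul_inv_cancel₀ (blowUpFibreCard_pos n k).ne',
      Complex.ofReal_one]
  · rw [if_neg hkk, if_neg hkk, mul_zero]

/-- `J` applied to a vector: `(J χ)(τ) = N(k)^{−1/2} χ(k)` with `k = blowUpCount τ`. [folklore] -/
theorem blowUpIso_mulVec_apply (n : ℕ) (χ : (V → Fin (n + 1)) → ℂ) (τ : V × Fin n → Fin 2) :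
    (blowUpIso n *ᵥ χ) τ =
      (((Real.sqrt (blowUpFibreCard n (blowUpCount n τ)))⁻¹ : ℝ) : ℂ) * χ (blowUpCount n τ) := by
  rw [Matrix.mulVec, dotProduct, Finset.sum_eq_single (blowUpCount n τ)]
  · rw [blowUpIso_apply, if_pos rfl]
  · intro k _ hk
    rw [blowUpIso_apply, if_neg (Ne.symm hk), zero_mul]
  · intro h; exact absurd (Finset.mem_univ _) h

/-- `Jᴴ` applied to a vector: `(Jᴴ ψ)(k) = N(k)^{−1/2} Σ_{blowUpCount τ = k} ψ(τ)`. [folklore] -/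
theorem blowUpIso_conjTranspose_mulVec_apply (n : ℕ) (ψ : (V × Fin n → Fin 2) → ℂ)
    (k : V → Fin (n + 1)) :
    ((blowUpIso n)ᴴ *ᵥ ψ) k =
      (((Real.sqrt (blowUpFibreCard n k))⁻¹ : ℝ) : ℂ) *
        ∑ τ ∈ Finset.univ.filter (fun τ : V × Fin n → Fin 2 => blowUpCount n τ = k), ψ τ := by
  rw [Matrix.mulVec, dotProduct, Finset.mul_sum, ← Finset.sum_filter_add_sum_filter_not Finset.univ
    (fun τ : V × Fin n → Fin 2 => blowUpCount n τ = k)]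
  have h2 : ∑ τ ∈ Finset.univ.filter (fun τ : V × Fin n → Fin 2 => ¬ blowUpCount n τ = k),
      (blowUpIso n)ᴴ k τ * ψ τ = 0 := by
    refine Finset.sum_eq_zero fun τ hτ => ?_
    rw [Finset.mem_filter] at hτ
    rw [Matrix.conjTranspose_apply, star_blowUpIso_apply, blowUpIso_apply, if_neg hτ.2, zero_mul]
  rw [h2, add_zero]
  refine Finset.sum_congr rfl fun τ hτ => ?_
  rw [Finset.mem_filter] at hτ
  rw [Matrix.conjTranspose_apply, star_blowUpIso_apply, blowUpIso_apply, if_pos hτ.2]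

end Summit.HubbardSuperconductivity.HubbardSuperconductivity.Theorems.AnisotropyChord
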